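import Literature.NumberTheory.EllipticCurves.PeriodLatticePresentationProofs
import Literature.NumberTheory.EllipticCurves.ModularParamXFunction
import Literature.NumberTheory.EllipticCurves.ModularCurveCoordinateRationality
import HarnessLib

/-!
# The `σ`-twisted level-one annihilator and an EXPLICIT presentation `℘_Λ(2πi∫f)·G = F`

Cell `bsd-f2-manin`, prover seat p3 (gen 16), crux C3 `ManinPrimeToThreeAtNine` (stmt-22968): analytic
ingredients of «`j(τ₁)` is algebraic at every pole `τ₁` of `x = ℘_Λ(2πi∫f)`» (`…ParamPoleJAlgebraic.lean`),
the algebraicity input of the modular-form witness stub of line `kato_shift_three` v23 (AN2).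
* `twistFun S n a c d τ = Δ(τ)^a ∏_{s ∈ S} (E₄(τ)³c(s) − d(s)Δ(τ))^{n(s)}` — the tree's level-one
  annihilator (`LevelOneAnnihilatorProofs`, `c = Δ|S`, `d = E₄³|S`) with free constants: a level-one
  form of weight `12(a + ∑ n(s))`, holomorphic, cuspidal for `a ≥ 1` (`twistCuspForm`), and **`σ` acts
  on its `q`-expansion through the constants** (`map_qExpansion_twistFun`; `E₄`, `Δ` have rational
  `q`-expansions, tree `isRatQExp_E₄`, `isRatQExp_discriminant`).
* `exists_explicit_presentation` — the tree's `exists_weierstrassP_eichlerIntegral_presentation_twelve_le`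
  (`PeriodLatticePresentationProofs`) re-run with the annihilator EXPOSED (`IsXPresentation f L F G`,
  `G = twistCuspForm S n a Δ|S E₄³|S`, `S` a finite set of poles meeting every `Γ₀(N)`-orbit of poles).
Everything is proved; no named fact.  BSD is not proved by this; C3 is not proved by this.
-/

set_option linter.dupNamespace false

noncomputable section

open Complex Filter Topology Set Function
open UpperHalfPlane hiding I
open scoped Real Topology Manifold MatrixGroups PeriodPair ModularForm
open ModularForm EisensteinSeries SlashInvariantForm ModularFormClass CongruenceSubgroup PowerSeries
open Literature.NumberTheory.EllipticCurves Literature.NumberTheory.EllipticCurves.ModularForms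

namespace Summit.BirchSwinnertonDyer.BirchSwinnertonDyer.Theorems.ManinLocalTwoThree.ParamPoleJ

/-! ### The twisted annihilator -/

section Twist

variable (S : Finset ℍ) (n : ℍ → ℕ) (a : ℕ) (c d : ℍ → ℂ)

/-- **The `σ`-twisted level-one annihilator** `τ ↦ Δ(τ)^a ∏_{s ∈ S} (E₄(τ)³c(s) − d(s)Δ(τ))^{n(s)}`;
for `c = Δ|_S`, `d = E₄³|_S` it is the tree's annihilator `Δ^a∏(E₄³Δ(s) − E₄(s)³Δ)^{n(s)}`.
[folklore] -/
def twistFun : ℍ → ℂ := fun τ ↦ ModularForm.discriminant τ ^ a *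
  ∏ s ∈ S, (E₄ τ ^ 3 * c s - d s * ModularForm.discriminant τ) ^ n s

/-- The untwisted case is the tree's annihilator. [folklore] -/
theorem twistFun_eq_annihilator : twistFun S n a (fun s ↦ ModularForm.discriminant s)
    (fun s ↦ E₄ s ^ 3) = fun τ ↦ ModularForm.discriminant τ ^ a *
      ∏ s ∈ S, (E₄ τ ^ 3 * ModularForm.discriminant s - E₄ s ^ 3 * ModularForm.discriminant τ) ^ n s :=
  rfl

/-- Each twisted factor is a level-one form of weight `12`. [folklore] -/
theorem twistFactor_apply_smul (s : ℍ) (γ : SL(2, ℤ)) (τ : ℍ) :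
    E₄ (γ • τ) ^ 3 * c s - d s * ModularForm.discriminant (γ • τ) =
      denom γ τ ^ 12 * (E₄ τ ^ 3 * c s - d s * ModularForm.discriminant τ) := by
  rw [levelOne_apply_smul E₄ γ τ, discriminant_apply_smul γ τ, zpow_ofNat, zpow_ofNat]
  ring

/-- **Transformation law**: `twistFun (γτ) = (cτ + d)^{12(a + ∑ n(s))} twistFun τ`. [folklore] -/
theorem twistFun_apply_smul (γ : SL(2, ℤ)) (τ : ℍ) :
    twistFun S n a c d (γ • τ) = denom γ τ ^ (12 * (a + ∑ s ∈ S, n s)) * twistFun S n a c d τ := by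
  have key : ∀ s ∈ S, (E₄ (γ • τ) ^ 3 * c s - d s * ModularForm.discriminant (γ • τ)) ^ n s =
      (denom γ τ ^ 12) ^ n s * (E₄ τ ^ 3 * c s - d s * ModularForm.discriminant τ) ^ n s := by
    intro s _
    rw [← mul_pow, twistFactor_apply_smul]
  rw [twistFun, twistFun, Finset.prod_congr rfl key, Finset.prod_mul_distrib,
    Finset.prod_pow_eq_pow_sum, discriminant_apply_smul γ τ, zpow_ofNat, mul_pow, ← pow_mul,
    ← pow_mul]
  ring

/-- **Slash invariance** of weight `12(a + ∑ n(s))` under `SL(2, ℤ)`. [folklore] -/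
theorem twistFun_slash (γ : SL(2, ℤ)) :
    twistFun S n a c d ∣[((12 * (a + ∑ s ∈ S, n s) : ℕ) : ℤ)] γ = twistFun S n a c d := by
  funext τ
  rw [ModularForm.SL_slash_apply, twistFun_apply_smul, zpow_neg, zpow_natCast,
    mul_comm (denom γ τ ^ _) _, mul_assoc, mul_inv_cancel₀ (pow_ne_zero _ (denom_ne_zero γ τ)),
    mul_one]

/-- The twisted factor `∘ ofComplex` is analytic on the upper half-plane. [folklore] -/
theorem analyticAt_twistFactor (s : ℍ) {z : ℂ} (hz : 0 < z.im) :
    AnalyticAt ℂ (fun w : ℂ ↦ E₄ (ofComplex w) ^ 3 * c s - d s * ModularForm.discriminant (ofComplex w))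
      z :=
  (((analyticOnNhd_E₄_comp_ofComplex z hz).pow 3).mul analyticAt_const).sub
    (analyticAt_const.mul (analyticOnNhd_discriminant_comp_ofComplex z hz))

/-- **`twistFun ∘ ofComplex` is analytic on the upper half-plane.** [folklore] -/
theorem analyticAt_twistFun {z : ℂ} (hz : 0 < z.im) :
    AnalyticAt ℂ (twistFun S n a c d ∘ ofComplex) z := by
  show AnalyticAt ℂ (fun w : ℂ ↦ ModularForm.discriminant (ofComplex w) ^ a *
      ∏ s ∈ S, (E₄ (ofComplex w) ^ 3 * c s - d s * ModularForm.discriminant (ofComplex w)) ^ n s) z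
  exact ((analyticOnNhd_discriminant_comp_ofComplex z hz).pow a).mul
    (Finset.analyticAt_fun_prod S fun s _ ↦ (analyticAt_twistFactor c d s hz).pow (n s))

/-- `twistFun ∘ ofComplex` is analytic on `{im > 0}`. [folklore] -/
theorem analyticOnNhd_twistFun :
    AnalyticOnNhd ℂ (twistFun S n a c d ∘ ofComplex) {z : ℂ | 0 < z.im} :=
  fun _ hz ↦ analyticAt_twistFun S n a c d hz

/-- **`twistFun` is holomorphic on `ℍ`.** [folklore] -/
theorem mdifferentiable_twistFun : MDifferentiable 𝓘(ℂ) 𝓘(ℂ) (twistFun S n a c d) :=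
  UpperHalfPlane.mdifferentiable_iff.mpr (analyticOnNhd_twistFun S n a c d).differentiableOn

/-- At `i∞` the product of the twisted factors tends to `∏ c(s)^{n(s)}`. [folklore] -/
theorem tendsto_twistFun_prod_atImInfty :
    Tendsto (fun τ : ℍ ↦ ∏ s ∈ S, (E₄ τ ^ 3 * c s - d s * ModularForm.discriminant τ) ^ n s)
      atImInfty (𝓝 (∏ s ∈ S, c s ^ n s)) := by
  have h1 : Tendsto (fun τ : ℍ ↦ E₄ τ) atImInfty (𝓝 1) :=
    ModularForm.tendsto_E_atImInfty (by norm_num) ⟨2, rfl⟩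
  have h2 : Tendsto ModularForm.discriminant atImInfty (𝓝 0) := discriminant_isZeroAtImInfty
  refine tendsto_finsetProd S fun s _ ↦ ?_
  have := (((h1.pow 3).mul_const (c s)).sub (h2.const_mul (d s))).pow (n s)
  simpa using this

/-- **`twistFun → 0` at `i∞`** for `a ≥ 1`. [folklore] -/
theorem isZeroAtImInfty_twistFun (ha : 1 ≤ a) : IsZeroAtImInfty (twistFun S n a c d) := by
  have h2 : Tendsto ModularForm.discriminant atImInfty (𝓝 0) := discriminant_isZeroAtImInfty
  have h3 : Tendsto (fun τ : ℍ ↦ ModularForm.discriminant τ ^ a) atImInfty (𝓝 0) := by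
    have := h2.pow a
    rwa [zero_pow (by omega)] at this
  have := h3.mul (tendsto_twistFun_prod_atImInfty S n c d)
  rw [zero_mul] at this
  exact this

/-- `twistFun ∣ g → 0` at `i∞` for every `g ∈ SL(2, ℤ)` (level one). [folklore] -/
theorem isZeroAtImInfty_twistFun_slash (ha : 1 ≤ a) (g : SL(2, ℤ)) :
    IsZeroAtImInfty (twistFun S n a c d ∣[((12 * (a + ∑ s ∈ S, n s) : ℕ) : ℤ)] g) := by
  rw [twistFun_slash]; exact isZeroAtImInfty_twistFun S n a c d ha

variable (N : ℕ) [NeZero N] in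
/-- **The twisted annihilator as a cusp form on `Γ₀(N)`** (`a ≥ 1`; it is even a level-one cusp
form). [folklore] -/
def twistCuspForm (ha : 1 ≤ a) : CuspForm (Gamma0 N) ((12 * (a + ∑ s ∈ S, n s) : ℕ) : ℤ) where
  toFun := twistFun S n a c d
  slash_action_eq' := fun A hA ↦ by
    obtain ⟨γ, -, rfl⟩ := hA
    exact twistFun_slash S n a c d γ
  holo' := mdifferentiable_twistFun S n a c d
  zero_at_cusps' := fun {c'} hc ↦ by
    rw [Subgroup.IsArithmetic.isCusp_iff_isCusp_SL2Z] at hc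
    rw [OnePoint.isZeroAt_iff_forall_SL2Z hc]
    intro g _
    exact isZeroAtImInfty_twistFun_slash S n a c d ha g

/-- `twistCuspForm` as a function is `twistFun`. [folklore] -/
@[simp] theorem coe_twistCuspForm {N : ℕ} [NeZero N] (ha : 1 ≤ a) :
    (⇑(twistCuspForm S n a c d N ha) : ℍ → ℂ) = twistFun S n a c d := rfl

/-- `twistCuspForm ≠ 0` as soon as `∏ c(s)^{n(s)} ≠ 0` (high in the cusp the product of the factors
is close to that limit and `Δ ≠ 0`). [folklore] -/
theorem exists_twistFun_ne_zero (hc : ∏ s ∈ S, c s ^ n s ≠ 0) : ∃ τ : ℍ, twistFun S n a c d τ ≠ 0 := by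
  have hev : ∀ᶠ τ : ℍ in atImInfty,
      ∏ s ∈ S, (E₄ τ ^ 3 * c s - d s * ModularForm.discriminant τ) ^ n s ≠ 0 :=
    (tendsto_twistFun_prod_atImInfty S n c d).eventually_ne hc
  obtain ⟨τ, hτ⟩ := hev.exists
  exact ⟨τ, mul_ne_zero (pow_ne_zero _ (ModularForm.discriminant_ne_zero τ)) hτ⟩

end Twist

/-! ### `σ` acts on the `q`-expansion of the twisted annihilator through the constants

The bookkeeping predicate is spelled out as a conjunction (no auxiliary structure): for
`φ ψ : ℍ → ℂ`, "`σ` twists `φ` to `ψ`" means both period-`1` cusp functions are analytic at `q = 0`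
and `σ` maps the `q`-expansion of `φ` to that of `ψ` coefficientwise. -/

section QTwist

variable {σ : ℂ →+* ℂ} {φ ψ φ' ψ' : ℍ → ℂ}

/-- From a `σ`-fixed `q`-expansion (`IsRatQExp`). [folklore] -/
theorem qTwist_of_isRatQExp (h : IsRatQExp σ φ) :
    AnalyticAt ℂ (cuspFunction 1 φ) 0 ∧ AnalyticAt ℂ (cuspFunction 1 φ) 0 ∧
      (qExpansion 1 φ).map σ = qExpansion 1 φ :=
  ⟨h.analyticAt, h.analyticAt, h.map_eq⟩

/-- Products. [folklore] -/
theorem qTwist_mul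
    (h : AnalyticAt ℂ (cuspFunction 1 φ) 0 ∧ AnalyticAt ℂ (cuspFunction 1 ψ) 0 ∧
      (qExpansion 1 φ).map σ = qExpansion 1 ψ)
    (h' : AnalyticAt ℂ (cuspFunction 1 φ') 0 ∧ AnalyticAt ℂ (cuspFunction 1 ψ') 0 ∧
      (qExpansion 1 φ').map σ = qExpansion 1 ψ') :
    AnalyticAt ℂ (cuspFunction 1 (φ * φ')) 0 ∧ AnalyticAt ℂ (cuspFunction 1 (ψ * ψ')) 0 ∧
      (qExpansion 1 (φ * φ')).map σ = qExpansion 1 (ψ * ψ') := by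
  obtain ⟨h1, h2, h3⟩ := h
  obtain ⟨h1', h2', h3'⟩ := h'
  refine ⟨?_, ?_, ?_⟩
  · rw [UpperHalfPlane.cuspFunction_mul h1.continuousAt h1'.continuousAt]; exact h1.mul h1'
  · rw [UpperHalfPlane.cuspFunction_mul h2.continuousAt h2'.continuousAt]; exact h2.mul h2'
  · rw [UpperHalfPlane.qExpansion_mul h1 h1', UpperHalfPlane.qExpansion_mul h2 h2', map_mul, h3, h3']

/-- Differences. [folklore] -/
theorem qTwist_sub
    (h : AnalyticAt ℂ (cuspFunction 1 φ) 0 ∧ AnalyticAt ℂ (cuspFunction 1 ψ) 0 ∧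
      (qExpansion 1 φ).map σ = qExpansion 1 ψ)
    (h' : AnalyticAt ℂ (cuspFunction 1 φ') 0 ∧ AnalyticAt ℂ (cuspFunction 1 ψ') 0 ∧
      (qExpansion 1 φ').map σ = qExpansion 1 ψ') :
    AnalyticAt ℂ (cuspFunction 1 (φ - φ')) 0 ∧ AnalyticAt ℂ (cuspFunction 1 (ψ - ψ')) 0 ∧
      (qExpansion 1 (φ - φ')).map σ = qExpansion 1 (ψ - ψ') := by
  obtain ⟨h1, h2, h3⟩ := h
  obtain ⟨h1', h2', h3'⟩ := h'
  refine ⟨?_, ?_, ?_⟩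
  · rw [UpperHalfPlane.cuspFunction_sub h1.continuousAt h1'.continuousAt]; exact h1.sub h1'
  · rw [UpperHalfPlane.cuspFunction_sub h2.continuousAt h2'.continuousAt]; exact h2.sub h2'
  · rw [UpperHalfPlane.qExpansion_sub h1 h1', UpperHalfPlane.qExpansion_sub h2 h2', map_sub, h3, h3']

/-- Scalars are moved by `σ`. [folklore] -/
theorem qTwist_smul
    (h : AnalyticAt ℂ (cuspFunction 1 φ) 0 ∧ AnalyticAt ℂ (cuspFunction 1 ψ) 0 ∧
      (qExpansion 1 φ).map σ = qExpansion 1 ψ) (k : ℂ) :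
    AnalyticAt ℂ (cuspFunction 1 (k • φ)) 0 ∧ AnalyticAt ℂ (cuspFunction 1 (σ k • ψ)) 0 ∧
      (qExpansion 1 (k • φ)).map σ = qExpansion 1 (σ k • ψ) := by
  obtain ⟨h1, h2, h3⟩ := h
  refine ⟨?_, ?_, ?_⟩
  · rw [UpperHalfPlane.cuspFunction_smul h1.continuousAt]; exact h1.const_smul
  · rw [UpperHalfPlane.cuspFunction_smul h2.continuousAt]; exact h2.const_smul
  · rw [UpperHalfPlane.qExpansion_smul h1, UpperHalfPlane.qExpansion_smul h2,
      PowerSeries.smul_eq_C_mul, PowerSeries.smul_eq_C_mul, map_mul, PowerSeries.map_C, h3]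

/-- The constant function `1`. [folklore] -/
theorem qTwist_one (σ : ℂ →+* ℂ) :
    AnalyticAt ℂ (cuspFunction 1 (1 : ℍ → ℂ)) 0 ∧ AnalyticAt ℂ (cuspFunction 1 (1 : ℍ → ℂ)) 0 ∧
      (qExpansion 1 (1 : ℍ → ℂ)).map σ = qExpansion 1 (1 : ℍ → ℂ) := by
  have h1 : cuspFunction 1 (1 : ℍ → ℂ) = 1 := by
    ext q
    rcases eq_or_ne q 0 with rfl | hq
    · simpa [cuspFunction, Periodic.cuspFunction] using! tendsto_const_nhds.limUnder_eq
    · simp [cuspFunction, Periodic.cuspFunction_eq_of_nonzero 1 _ hq]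
  have han : AnalyticAt ℂ (cuspFunction 1 (1 : ℍ → ℂ)) 0 := by rw [h1]; exact analyticAt_const
  exact ⟨han, han, by rw [UpperHalfPlane.qExpansion_one, map_one]⟩

/-- Powers. [folklore] -/
theorem qTwist_pow
    (h : AnalyticAt ℂ (cuspFunction 1 φ) 0 ∧ AnalyticAt ℂ (cuspFunction 1 ψ) 0 ∧
      (qExpansion 1 φ).map σ = qExpansion 1 ψ) (k : ℕ) :
    AnalyticAt ℂ (cuspFunction 1 (φ ^ k)) 0 ∧ AnalyticAt ℂ (cuspFunction 1 (ψ ^ k)) 0 ∧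
      (qExpansion 1 (φ ^ k)).map σ = qExpansion 1 (ψ ^ k) := by
  induction k with
  | zero => simpa using qTwist_one σ
  | succ k ih => rw [pow_succ, pow_succ]; exact qTwist_mul ih h

/-- Finite products. [folklore] -/
theorem qTwist_prod {ι : Type*} (σ : ℂ →+* ℂ) (T : Finset ι) {Φ Ψ : ι → ℍ → ℂ}
    (h : ∀ i ∈ T, AnalyticAt ℂ (cuspFunction 1 (Φ i)) 0 ∧ AnalyticAt ℂ (cuspFunction 1 (Ψ i)) 0 ∧
      (qExpansion 1 (Φ i)).map σ = qExpansion 1 (Ψ i)) :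
    AnalyticAt ℂ (cuspFunction 1 (∏ i ∈ T, Φ i)) 0 ∧ AnalyticAt ℂ (cuspFunction 1 (∏ i ∈ T, Ψ i)) 0 ∧
      (qExpansion 1 (∏ i ∈ T, Φ i)).map σ = qExpansion 1 (∏ i ∈ T, Ψ i) := by
  classical
  induction T using Finset.induction_on with
  | empty => simpa using qTwist_one σ
  | insert i T hi ih =>
    rw [Finset.prod_insert hi, Finset.prod_insert hi]
    exact qTwist_mul (h i (Finset.mem_insert_self i T)) (ih fun j hj ↦ h j (Finset.mem_insert_of_mem hj))

/-- `twistFun` written with pointwise operations on functions. [folklore] -/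
theorem twistFun_eq_pi (S : Finset ℍ) (n : ℍ → ℕ) (a : ℕ) (c d : ℍ → ℂ) :
    twistFun S n a c d = ModularForm.discriminant ^ a *
      ∏ s ∈ S, (c s • (⇑ModularForm.E₄) ^ 3 - d s • ModularForm.discriminant) ^ n s := by
  funext τ
  simp only [twistFun, Pi.mul_apply, Pi.pow_apply, Finset.prod_apply, Pi.sub_apply,
    Pi.smul_apply, smul_eq_mul]
  congr 1
  refine Finset.prod_congr rfl fun s _ ↦ ?_
  ring

/-- **`σ` acts on the `q`-expansion of the twisted annihilator through its constants**:
`σ(q-exp(twistFun c d)) = q-exp(twistFun (σ ∘ c) (σ ∘ d))`, and both cusp functions are analytic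
at `q = 0` (`E₄`, `Δ` have rational `q`-expansions: tree `isRatQExp_E₄`, `isRatQExp_discriminant`).
[folklore] -/
theorem qTwist_twistFun (σ : ℂ →+* ℂ) (S : Finset ℍ) (n : ℍ → ℕ) (a : ℕ) (c d : ℍ → ℂ) :
    AnalyticAt ℂ (cuspFunction 1 (twistFun S n a c d)) 0 ∧
      AnalyticAt ℂ (cuspFunction 1 (twistFun S n a (fun s ↦ σ (c s)) (fun s ↦ σ (d s)))) 0 ∧
      (qExpansion 1 (twistFun S n a c d)).map σ =
        qExpansion 1 (twistFun S n a (fun s ↦ σ (c s)) (fun s ↦ σ (d s))) := by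
  have hE := qTwist_of_isRatQExp (isRatQExp_E₄ σ)
  have hΔ : AnalyticAt ℂ (cuspFunction 1 ModularForm.discriminant) 0 ∧
      AnalyticAt ℂ (cuspFunction 1 ModularForm.discriminant) 0 ∧
      (qExpansion 1 ModularForm.discriminant).map σ = qExpansion 1 ModularForm.discriminant :=
    qTwist_of_isRatQExp (isRatQExp_discriminant σ)
  rw [twistFun_eq_pi, twistFun_eq_pi]
  exact qTwist_mul (qTwist_pow hΔ a) (qTwist_prod σ S fun s _ ↦
    qTwist_pow (qTwist_sub (qTwist_smul (qTwist_pow hE 3) (c s)) (qTwist_smul hΔ (d s))) (n s))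

/-- The `q`-expansion form of `qTwist_twistFun`. [folklore] -/
theorem map_qExpansion_twistFun (σ : ℂ →+* ℂ) (S : Finset ℍ) (n : ℍ → ℕ) (a : ℕ) (c d : ℍ → ℂ) :
    (qExpansion 1 (twistFun S n a c d)).map σ =
      qExpansion 1 (twistFun S n a (fun s ↦ σ (c s)) (fun s ↦ σ (d s))) :=
  (qTwist_twistFun σ S n a c d).2.2

end QTwist

/-! ### The explicit presentation `℘_Λ(2πi∫f)·G = F` -/

section Presentation

variable {N : ℕ} [NeZero N]

/-- **Explicit presentation of `x = ℘_Λ(2πi∫f)` by cusp forms on `Γ₀(N)`** — the tree's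
`exists_weierstrassP_eichlerIntegral_presentation_twelve_le` (`PeriodLatticePresentationProofs`,
Shimura 1971 §2.4 / Thm. 7.14) re-run with the annihilator exposed: for `f ≠ 0` and `Λ ⊇ Λ_f` there
are a finite set `S ⊆ ℍ` of poles of `x` meeting every `Γ₀(N)`-orbit of poles, exponents `n`,
`a ≥ 1`, and a cusp form `F ∈ S_k(Γ₀(N))`, `k = 12(a + ∑ n(s))`, with
`℘_Λ(u)·G = F` off the poles for `G = Δ^a∏_{s ∈ S}(E₄³Δ(s) − E₄(s)³Δ)^{n(s)}` (`twistCuspForm S n a Δ|S E₄³|S`).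
(adapted from Literature/NumberTheory/EllipticCurves/PeriodLatticePresentationProofs.lean)
[cite: ShimuraIATAF1971, §2.4] -/
theorem exists_explicit_presentation (f : CuspForm (Gamma0 N) 2) (hf : f ≠ 0) (L : PeriodPair)
    (hΛ : ∀ x ∈ periodLattice f, x ∈ L.lattice) :
    ∃ (S : Finset ℍ) (n : ℍ → ℕ) (a : ℕ) (ha : 1 ≤ a)
      (F : CuspForm (Gamma0 N) ((12 * (a + ∑ s ∈ S, n s) : ℕ) : ℤ)),
      (∀ s ∈ S, eichlerIntegral f s ∈ L.lattice) ∧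
      (∀ τ : ℍ, eichlerIntegral f τ ∈ L.lattice → ∃ γ ∈ Gamma0 N, ∃ s ∈ S, τ = γ • s) ∧
      IsXPresentation f L F
        (twistCuspForm S n a (fun s ↦ ModularForm.discriminant s) (fun s ↦ E₄ s ^ 3) N ha) := by
  classical
  -- poles and cusps
  obtain ⟨S, hSP, hS⟩ := exists_finset_poles f hf L hΛ
  obtain ⟨R, hR⟩ := exists_finset_mul_cover (Gamma0 N)
  -- exponents
  set m : SL(2, ℤ) → ℕ := fun r ↦
    analyticOrderNatAt (cuspFunction N (verticalIntegral (⇑f ∣[(2 : ℤ)] r))) 0 with hm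
  set a : ℕ := 1 + ∑ r ∈ R, (2 * m r + 1) with ha
  have ha1 : 1 ≤ a := Nat.le_add_right _ _
  have haR : ∀ r ∈ R, 2 * m r + 1 ≤ a := fun r hr ↦
    (Finset.single_le_sum (f := fun r ↦ 2 * m r + 1) (fun _ _ ↦ Nat.zero_le _) hr).trans
      (Nat.le_add_left _ _)
  set n : ℍ → ℕ := fun s ↦ 2 * analyticOrderNatAt (fun w : ℂ ↦
    eichlerIntegral f (ofComplex w) - eichlerIntegral f (ofComplex (s : ℂ))) s with hn
  set K : ℕ := 12 * (a + ∑ s ∈ S, n s) with hK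
  set Gf : ℍ → ℂ := twistFun S n a (fun s ↦ ModularForm.discriminant s) (fun s ↦ E₄ s ^ 3) with hGf
  -- properties of `G` (the tree's annihilator, definitionally)
  have hGan : AnalyticOnNhd ℂ (Gf ∘ ofComplex) {z : ℂ | 0 < z.im} := analyticOnNhd_twistFun S n a _ _
  have hGsmul : ∀ (γ : SL(2, ℤ)) (τ : ℍ), Gf (γ • τ) = denom γ τ ^ K * Gf τ :=
    fun γ τ ↦ twistFun_apply_smul S n a _ _ γ τ
  have hGslash : ∀ γ : SL(2, ℤ), Gf ∣[(K : ℤ)] γ = Gf := fun γ ↦ twistFun_slash S n a _ _ γ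
  -- `G` kills the poles of `x`
  have hkill : ∀ z : ℂ, 0 < z.im → eichlerIntegral f (ofComplex z) ∈ L.lattice →
      0 ≤ meromorphicOrderAt ((fun w : ℂ ↦ ℘[L] (eichlerIntegral f (ofComplex w))) *
        (Gf ∘ ofComplex)) z := by
    intro z hz hzL
    have hzL' : eichlerIntegral f ⟨z, hz⟩ ∈ L.lattice := by
      rwa [ofComplex_apply_of_im_pos hz] at hzL
    obtain ⟨γ, hγ, s, hs, hzs⟩ := hS ⟨z, hz⟩ hzL'
    have hzeq : z = ((γ • s : ℍ) : ℂ) := congrArg UpperHalfPlane.coe hzs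
    have hsL : eichlerIntegral f (ofComplex (s : ℂ)) ∈ L.lattice := by
      rw [ofComplex_apply]; exact hSP s hs
    have hXs := meromorphicOrderAt_weierstrassP_eichlerIntegral f hf L s.im_pos hsL
    have hXz : meromorphicOrderAt (fun w : ℂ ↦ ℘[L] (eichlerIntegral f (ofComplex w))) z =
        (((-2 : ℤ) * (analyticOrderNatAt (fun w : ℂ ↦ eichlerIntegral f (ofComplex w) -
          eichlerIntegral f (ofComplex (s : ℂ))) s : ℕ) : ℤ) : WithTop ℤ) := by
      rw [hzeq]
      exact (meromorphicOrderAt_weierstrassP_eichlerIntegral_smul f L hΛ ⟨γ, hγ⟩ s).trans hXs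
    have hGord : (n s : ℕ∞) ≤ analyticOrderAt (Gf ∘ ofComplex) z := by
      rw [hzeq, hGf, twistFun_eq_annihilator]
      exact natCast_le_analyticOrderAt_levelOneAnnihilator S n a hs γ
    refine meromorphicOrderAt_mul_nonneg_of_natCast_le
      (meromorphicAt_weierstrassP_eichlerIntegral f L hz) hXz ?_ (hGan z hz) hGord
    simp only [hn]
    push_cast
    omega
  -- the holomorphic invariant extension `F` of `x·G`
  obtain ⟨Ff, hFmd, hFslash, hFG⟩ := exists_invariant_extension f hf L hΛ Gf K hGan hGsmul hkill
  -- vanishing at the cusps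
  have hprodlim := tendsto_twistFun_prod_atImInfty S n (fun s ↦ ModularForm.discriminant s)
    (fun s ↦ E₄ s ^ 3)
  have hFzero : ∀ g : SL(2, ℤ), IsZeroAtImInfty (Ff ∣[(K : ℤ)] g) := by
    intro g
    obtain ⟨γ, hγ, r, hr, rfl⟩ := hR g
    rw [SlashAction.slash_mul, hFslash γ hγ]
    exact isZeroAtImInfty_slash_of_presentation f hf L Ff Gf _ (K : ℤ) a r hFG (hGslash r)
      (fun τ ↦ rfl) hprodlim (haR r hr)
  -- the cusp form `F` on `Γ₀(N)`
  let F₀ : CuspForm (Gamma0 N) (K : ℤ) :=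
    { toFun := Ff
      slash_action_eq' := fun A hA ↦ by
        obtain ⟨γ, hγ, rfl⟩ := hA
        exact hFslash γ hγ
      holo' := hFmd
      zero_at_cusps' := fun {c} hc ↦ by
        rw [Subgroup.IsArithmetic.isCusp_iff_isCusp_SL2Z] at hc
        rw [OnePoint.isZeroAt_iff_forall_SL2Z hc]
        intro g _
        exact hFzero g }
  refine ⟨S, n, a, ha1, F₀, hSP, hS, ?_, fun τ hτ ↦ ?_⟩
  · -- `G ≠ 0`
    obtain ⟨τ₁, hτ₁⟩ := exists_twistFun_ne_zero S n a (fun s ↦ ModularForm.discriminant s)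
      (fun s ↦ E₄ s ^ 3) (prod_discriminant_pow_ne_zero S n)
    intro h0
    apply hτ₁
    have h1 := congrArg (fun G : CuspForm (Gamma0 N) (K : ℤ) ↦ (⇑G) τ₁) h0
    simp only [CuspForm.coe_zero, Pi.zero_apply] at h1
    exact h1
  · exact hFG τ hτ

end Presentation

end Summit.BirchSwinnertonDyer.BirchSwinnertonDyer.Theorems.ManinLocalTwoThree.ParamPoleJ

end
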